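import Literature.MathematicalPhysics.QuantumFieldTheory.Balaban1983to89.B9Eq3126ConjugatedQG1QInvTower
import Literature.MathematicalPhysics.QuantumFieldTheory.Balaban1983to89.B9Eq349BondPointDecayFromCircle
import Literature.MathematicalPhysics.QuantumFieldTheory.Balaban1983to89.B9Eq3101ExpPointwiseMultiplier

/-!
# `Balaban1983to89.B9Eq3126QG1QInvPointDecayTower` — T. Bałaban, *Propagators for lattice gauge theories in a background field*, Commun. Math. Phys. **99**
# (1985) 389–434 [Balaban1985BackgroundPropagators] (3.42) p. 398, (3.49) p. 399, (3.126) p. 420, Thm 3.11 p. 416 with [Balaban1985Variational] (45) p. 285,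
# (110) p. 294: **THE EXPONENTIAL POINT DECAY OF THE KERNEL OF `(Q_kG₁(U)Q_k*)⁻¹` ON THE UNIT LATTICE OF COARSE BONDS, AT EVERY HEIGHT OF THE TOWER** — the
# TOWER PORT of `B9Eq3126QG1QInvPointDecay`: `B9Eq349BondPointDecayFromCircle.norm_bondPoint_le_exp_of_uniform_circle_bound_cast` (typing
# `towerP L m (n+1) = fineP (L^(n+1)) m`, `B9Eq316TowerFlatIsOneStep.towerP_eq_fineP_pow`) INSTANTIATED at `c = (Q_kG₁Q_k*)⁻¹ = B11Eq103H1Complex.KinvLatticeK`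
# for `B9Eq326OperatorTower.laplaceAk` ∕ `G1k` ∕ `QkW`, the circle letter SUPPLIED by `B9Eq3126ConjugatedQG1QInvTower.norm_conjKinv_le` (`C = 2∕μ₁`) at the
# operator exponentials of the pointwise multipliers, on the diagonal `ηL^{n+1} = 1`; text = the one-step file's with `fineP ↦ towerP … (n+1)`, `Q ↦ QkW`,
# block size `L ↦ L^(n+1)` in the read-out

statement-level skeleton of published theorems with citation tags; proofs where landed; nothing here is a claim about the Yang–Mills mass gap

CITATION HEADER (lean-in-tree rule).  Audit cell `pub-balaban`, sub-cell `t4`, BINDER row NE9 (road ΔA-CT, tower form; NE9 formalisation-swarm leaf prover 03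
`b2b-balaban-t4-ne9-formalise-leaf-03` gen 75).  Sources READ first-hand: [Balaban1985BackgroundPropagators] p. 398 (3.42), p. 399 (3.49) (print's `δ₀` NOT
asserted: the rate is the radius `r` the displayed windows allow), p. 416 Thm 3.11, p. 420 (3.126); [Balaban1985Variational] p. 285 (45), p. 294 (110).

WHAT IS PROVED (sorry-free; proof lane — no `def`; [folklore] composition BY NAME).
* **`norm_bondPoint_Kinv_le`** — every height `n`: `‖r_{y₁} ∘ (Q_kG₁(U)Q_k*)⁻¹ ∘ r_{y₀}‖ ≤ (2∕μ₁)·e^{r}·e^{−r·d_m(y₀,y₁)}` for every background of the letters at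
  height `n+1`, `Q_k` onto displayed as `hQs` (= `B9Eq326OperatorTower.QkW_surjective` under `hαL`), in the radius windows, given the displayed letters uniformly
  over the fine site weights `χ` on `towerP L m (n+1)` (bond increments `≤ ℓη`), their coarse companions `χ′` (`|χ′(y) − χ(x)| ≤ ℓ′` on the big block of `y`,
  read through `siteCast`) and the circle `‖κ‖ = r`.
HONEST SCOPE.  Composition; displayed: `γ`, `μ₁`, `p_K`, `β_K`, `C_Q`, the conjugated `Q_k(U)` letters (no supplier in the tree), `ρ` (supplier
`B9Eq349ConjugatedProjectionDifferenceChainTower`), `C_P` (supplier `B9Eq325ProjectionDivergenceQuarterKappaTower`), the windows; NO height, NO `η`, NO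
volume in the constants; CELL-ONLY by the refuter desk's §1 (letters) — agreed; NOT NE9 (cell pub-balaban: NE9 NOT PRINTED ∕ NOT PROVED; «NE9 ⇐ the named
binders»; row WALLED ON A MODEL (O-NE9-1; #5 UNRULED); spine PROVED 0∕9; rung (B)+1 on a finite T⁴ — NOT infinite volume, NOT mass gap, NOT BetaPertH, NOT Clay;
HONEST DEPENDENCY: continuum YM on T⁴ ⇐ BetaPertH ∧ nine spine estimates (0/9 proved); BetaPertH ⇐ (D1) ∧ (D4) ∧ CAP+tail).  NEW file; nothing modified.
Net new unproved facts: 0.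
-/

noncomputable section

open scoped InnerProductSpace ComplexConjugate
open NormedSpace

namespace Literature.MathematicalPhysics.QuantumFieldTheory.Balaban1983to89.B9Eq3126QG1QInvPointDecayTower

open B4Sect5Torus (TSite tdist)
open B9SectCLatticeCarrier (Bond bpos btgt)
open B9Eq311L2Pairing (WL2)
open B9Eq319QprimeTorus (fineP blockCoord)
open B9Eq315QTower (towerP)
open B9Eq315QTorus (perCfg cornerSite)
open B7Prop1Explicit (Wcx boxVec)
open B9Eq316TowerFlatIsOneStep (siteCast towerP_eq_fineP_pow)
open B7Prop1Explicit (U1)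
open B11Eq103H1Complex (SiteL2K BondL2K covDivL2K KinvLatticeK)
open B9Eq310HessianOperator (adTransportW PlaqL2K curvOp)
open B9Eq326OperatorTower (laplaceAk RofUk G1k QkW)
open B9Eq326ConjugatedDeltaATower (apply_inv_apply' apply_apply_inv')
open B9Eq3126ConjugatedQG1QInvTower (norm_conjKinv_le)
open B9Eq3101ExpPointwiseMultiplier (equiv_exp_smul_apply_complex equiv_exp_smul_neg_apply_complex)
open B9Eq387IMSLocalLettersLattice (exists_pointwise_clm)
open B9Eq349BondPointDecayFromCircle (norm_bondPoint_le_exp_of_uniform_circle_bound_cast)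

/-! ## The instance: point decay of `(Q_kG₁(U)Q_k*)⁻¹` on the coarse bonds, every height -/

section Instance

variable {d : ℕ} {L : ℕ} [NeZero L] {m : Fin d → ℕ} [∀ i, NeZero (m i)] {n : ℕ}
  {𝔸 : Type*} [NormedRing 𝔸] [StarRing 𝔸] [NormedAlgebra ℂ 𝔸] [StarModule ℂ 𝔸] [CompleteSpace 𝔸] [NormOneClass 𝔸]
  {W : Type*} [NormedAddCommGroup W] [InnerProductSpace ℂ W] [FiniteDimensional ℂ W] (φ : W ≃ₗ[ℂ] 𝔸) {Mφ Mφ' : ℝ}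
  (hφ : ∀ w, ‖φ w‖ ≤ Mφ * ‖w‖) (hφ' : ∀ X, ‖φ.symm X‖ ≤ Mφ' * ‖X‖) (hMφ : 0 ≤ Mφ) (hMφ' : 0 ≤ Mφ')
  {c₀ : ℝ} [Fact (0 < c₀)] {c₁ : ℝ} [Fact (0 < c₁)] {η : ℝ} (hη : 0 < η) (hηL : η * (L : ℝ) ^ (n + 1) = 1)
  (U : Bond d (towerP L m (n + 1)) → 𝔸ˣ) (hU : ∀ b, U b ∈ U1 𝔸)
  (hRS : ∀ (b : Bond d (towerP L m (n + 1))) (v u : W), ⟪adTransportW φ U b v, u⟫_ℂ = ⟪v, adTransportW φ (fun b => (U b)⁻¹) b u⟫_ℂ)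
  (τ : 𝔸 →ₗ[ℂ] ℂ) (hL : 1 ≤ L) (α : ℕ → ℝ) (hα1 : ∀ j, α j ≤ 1 / 64)
  (hU1 : ∀ (j : ℕ) (x : B7Prop1Explicit.Site d) (κ : Fin d), perCfg (towerP L m (j + 1)) (B9Eq315QTower.UlevOf L m (n + 1) U j) x κ ∈ U1 𝔸)
  (hreg : ∀ (j : ℕ) (y : TSite d (towerP L m j)) (κ : Fin d) (r : Fin d → Fin L),
    ‖((Wcx L (perCfg (towerP L m (j + 1)) (B9Eq315QTower.UlevOf L m (n + 1) U j)) (cornerSite L y) κ (boxVec L r) : 𝔸ˣ) : 𝔸) - 1‖ ≤ α j)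
  (a : ℝ)

include hφ hφ' hMφ hMφ' hη hηL hU hRS in
/-- **THE POINT DECAY OF `(QG₁(U)Q*)⁻¹` ON THE COARSE BONDS**: on the one-step torus at the diagonal `ηL = 1`, for `Δ_a(U) = Δ(U) + D_UR(U)D*_U + Q†(a•Q)` of
every background with `U(b) ∈ U1` and mutually adjoint transports and every `Q : L²(fine bonds) → L²(coarse bonds)` onto, given the `γ`-coercivity of `Δ_a`
(Thm 3.11), the lower bound `μ₁‖g‖² ≤ re⟪g, QG₁Q†g⟫` ([B11] (45)), the `Δ′` floor `p_K`, `‖Qf‖ ≤ C_Q‖f‖`, the complementary-projection letter `C_P`, the radius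
windows (`1 ≤ ℓ`, `1 ≤ ℓ′`, `rℓη ≤ 1`, `4rℓM_φM_φ′d√d ≤ β`, `4rℓM_φM_φ′d ≤ β`, `2rℓM_φM_φ′√d ≤ β`, `ρ ≤ 1∕8`, `small`, `small2`) and the conjugated `Q(U)` ∕ `Δ′` ∕
`R(U)` letters UNIFORMLY over the fine site weights `χ` (bond increments `≤ ℓη`), their coarse companions `χ′` (`|χ′(y) − χ(x)| ≤ ℓ′` on the block of `y`) and
the circle `‖κ‖ = r` (displayed): for the coarse-bond point family and every pair of coarse sites
`‖r_{y₁} ∘ (QG₁(U)Q*)⁻¹ ∘ r_{y₀}‖ ≤ (2∕μ₁)·e^{r}·e^{−r·d_m(y₀,y₁)}`.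
[cite: Balaban1985BackgroundPropagators, (3.49) p.399, (3.126) p.420, Thm 3.11 p.416; Balaban1985Variational, (45) p.285, (110) p.294] -/
theorem norm_bondPoint_Kinv_le (ha : 0 ≤ a) (hm : ∀ i, 1 ≤ m i)
    (hpos : ∀ x : BondL2K ℂ d (towerP L m (n + 1)) c₀ W, x ≠ 0 → 0 < RCLike.re ⟪x, laplaceAk L m n φ η U hL α hα1 hU1 hreg τ (c₀ := c₀) (c₁ := c₁) a x⟫_ℂ) (hQs : Function.Surjective (QkW L m n φ U hL α hα1 hU1 hreg (c₀ := c₀) (c₁ := c₁)))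
    {γ β βK pK ℓ ℓ' r ρ CP CQ μ₁ : ℝ} (hγ : 0 < γ) (hγ1 : γ ≤ 1) (hβ : 0 ≤ β) (hβ1 : β ≤ 1) (hβK : 0 ≤ βK) (hℓ : 1 ≤ ℓ) (hℓ' : 1 ≤ ℓ') (hr : 0 ≤ r)
    (hρ : 0 ≤ ρ) (hρ8 : ρ ≤ 1 / 8) (hCP : 0 ≤ CP) (hCQ : 0 ≤ CQ) (hμ₁ : 0 < μ₁)
    (hcoer : ∀ f : BondL2K ℂ d (towerP L m (n + 1)) c₀ W, γ * ‖f‖ ^ 2 ≤ RCLike.re ⟪f, laplaceAk L m n φ η U hL α hα1 hU1 hreg τ (c₀ := c₀) (c₁ := c₁) a f⟫_ℂ)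
    (hX1 : ∀ g : BondL2K ℂ d m c₁ W, μ₁ * ‖g‖ ^ 2 ≤ RCLike.re ⟪g, (QkW L m n φ U hL α hα1 hU1 hreg (c₀ := c₀) (c₁ := c₁)) (G1k L m n φ η U hL α hα1 hU1 hreg τ (c₀ := c₀) (c₁ := c₁) hpos (LinearMap.adjoint (QkW L m n φ U hL α hα1 hU1 hreg (c₀ := c₀) (c₁ := c₁)) g))⟫_ℂ)
    (hKre : ∀ f : BondL2K ℂ d (towerP L m (n + 1)) c₀ W, -(pK * ‖f‖ ^ 2) ≤ RCLike.re ⟪f, curvOp φ τ η U f⟫_ℂ)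
    (hQ : ∀ f, ‖(QkW L m n φ U hL α hα1 hU1 hreg (c₀ := c₀) (c₁ := c₁)) f‖ ≤ CQ * ‖f‖)
    (hwin : r * ℓ * η ≤ 1)
    (hβCC : 4 * r * ℓ * (Mφ * Mφ') * (d * Real.sqrt d) ≤ β) (hβC : 4 * r * ℓ * (Mφ * Mφ') * d ≤ β)
    (hβD : 2 * r * ℓ * (Mφ * Mφ') * Real.sqrt d ≤ β)
    (hQK : ∀ (χ : TSite d (towerP L m (n + 1)) → ℝ) (χ' : TSite d m → ℝ),
      (∀ b : Bond d (towerP L m (n + 1)), |χ (bpos b) - χ (btgt b)| ≤ ℓ * η) →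
      (∀ (y : TSite d m) (x : TSite d (towerP L m (n + 1))),
        siteCast (towerP_eq_fineP_pow L m (n + 1)) x ∈ B9Eq319QprimeTorus.blockOf (L ^ (n + 1)) m y → |χ' y - χ x| ≤ ℓ') →
      ∀ (MB : BondL2K ℂ d (towerP L m (n + 1)) c₀ W →L[ℂ] BondL2K ℂ d (towerP L m (n + 1)) c₀ W),
      (∀ (g : BondL2K ℂ d (towerP L m (n + 1)) c₀ W) (b : Bond d (towerP L m (n + 1))),
        WL2.equiv ℂ (fun _ : Bond d (towerP L m (n + 1)) => c₀) W (MB g) b = (χ (bpos b) : ℂ) • WL2.equiv ℂ (fun _ : Bond d (towerP L m (n + 1)) => c₀) W g b) →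
      ∀ (MS : SiteL2K ℂ d (towerP L m (n + 1)) c₀ W →L[ℂ] SiteL2K ℂ d (towerP L m (n + 1)) c₀ W),
      (∀ (g : SiteL2K ℂ d (towerP L m (n + 1)) c₀ W) (x : TSite d (towerP L m (n + 1))),
        WL2.equiv ℂ (fun _ : TSite d (towerP L m (n + 1)) => c₀) W (MS g) x = (χ x : ℂ) • WL2.equiv ℂ (fun _ : TSite d (towerP L m (n + 1)) => c₀) W g x) →
      ∀ (MF : BondL2K ℂ d m c₁ W →L[ℂ] BondL2K ℂ d m c₁ W),
      (∀ (g : BondL2K ℂ d m c₁ W) (b' : Bond d m),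
        WL2.equiv ℂ (fun _ : Bond d m => c₁) W (MF g) b' = (χ' (bpos b') : ℂ) • WL2.equiv ℂ (fun _ : Bond d m => c₁) W g b') →
      ∀ κ : ℂ, ‖κ‖ = r →
      (∀ f, ‖exp (κ • MF) ((QkW L m n φ U hL α hα1 hU1 hreg (c₀ := c₀) (c₁ := c₁)) (exp (κ • (-MB)) f)) - (QkW L m n φ U hL α hα1 hU1 hreg (c₀ := c₀) (c₁ := c₁)) f‖ ≤ β * ‖f‖) ∧
      (∀ g, ‖exp (κ • MB) (LinearMap.adjoint (QkW L m n φ U hL α hα1 hU1 hreg (c₀ := c₀) (c₁ := c₁)) (exp (κ • (-MF)) g)) - LinearMap.adjoint (QkW L m n φ U hL α hα1 hU1 hreg (c₀ := c₀) (c₁ := c₁)) g‖ ≤ β * ‖g‖) ∧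
      (∀ f, ‖exp (κ • MB) (curvOp φ τ η U (exp (κ • (-MB)) f)) - curvOp φ τ η U f‖ ≤ βK * ‖f‖) ∧
      (∀ s, ‖exp (κ • MS) (RofUk L m n φ η U (c₀ := c₀) (exp (κ • (-MS)) s)) - RofUk L m n φ η U (c₀ := c₀) s‖ ≤ ρ * ‖s‖))
    (hP : ∀ f, ‖covDivL2K ℂ c₀ ((η : ℂ))⁻¹ (adTransportW φ fun b => (U b)⁻¹) f -
      RofUk L m n φ η U (c₀ := c₀) (covDivL2K ℂ c₀ ((η : ℂ))⁻¹ (adTransportW φ fun b => (U b)⁻¹) f)‖ ≤ CP * ‖f‖)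
    (small : pK / 2 + (21 + 3 * a) * β ^ 2 + 4 * β * CP + 2 * ρ * CP ^ 2 + βK ≤ γ / 4)
    (small2 : β * (4 / γ) * (2 * CQ + 1) + CQ * (CQ + 1) *
        (β * (4 / γ * (2 * (8 / γ) + (8 / γ + 4 / γ) + 2 * ((8 / γ + 4 / γ * CP) + 4 / γ) + a * CQ * (4 / γ) + a * (CQ + 1) * (4 / γ))) +
          ρ * ((8 / γ + 4 / γ * CP) * ((8 / γ + 4 / γ * CP) + 4 / γ)) + βK * (4 / γ) ^ 2) ≤ μ₁ / 2)
    {rF : TSite d m → BondL2K ℂ d m c₁ W →L[ℂ] BondL2K ℂ d m c₁ W}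
    (hrF : ∀ (y : TSite d m) (g : BondL2K ℂ d m c₁ W) (b' : Bond d m),
      WL2.equiv ℂ (fun _ : Bond d m => c₁) W (rF y g) b' = if bpos b' = y then WL2.equiv ℂ (fun _ : Bond d m => c₁) W g b' else 0)
    (y₀ y₁ : TSite d m) :
    ‖rF y₁ ∘L LinearMap.toContinuousLinearMap (KinvLatticeK hpos hQs) ∘L rF y₀‖ ≤ 2 / μ₁ * Real.exp r * Real.exp (-(r * tdist m y₀ y₁)) := by
  have hL0 : (0 : ℝ) < L := by exact_mod_cast Nat.pos_of_ne_zero (NeZero.ne L)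
  have hLp : (0 : ℝ) < (L : ℝ) ^ (n + 1) := pow_pos hL0 _
  have hι : 1 / ((L ^ (n + 1) : ℕ) : ℝ) ≤ ℓ * η := by
    rw [Nat.cast_pow, div_le_iff₀ hLp]
    calc (1 : ℝ) = 1 * (η * (L : ℝ) ^ (n + 1)) := by rw [hηL, mul_one]
      _ ≤ ℓ * (η * (L : ℝ) ^ (n + 1)) := by gcongr
      _ = ℓ * η * (L : ℝ) ^ (n + 1) := by ring
  refine norm_bondPoint_le_exp_of_uniform_circle_bound_cast m (towerP_eq_fineP_pow L m (n + 1)) hm _ hrF hr (by positivity) hι hℓ'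
    (fun χ χ' hχ hχ' MF hMF κ hκr => ?_) y₀ y₁
  -- the fine multipliers of this weight
  obtain ⟨MB, hMB⟩ := exists_pointwise_clm (𝕜 := ℂ) (w := fun _ : Bond d (towerP L m (n + 1)) => c₀) (V := W) (fun b : Bond d (towerP L m (n + 1)) => bpos b) χ
  obtain ⟨MP, hMP⟩ := exists_pointwise_clm (𝕜 := ℂ) (w := fun _ : B9SectCLatticeCarrier.Plaq d (towerP L m (n + 1)) => c₀) (V := W)
    (fun p : B9SectCLatticeCarrier.Plaq d (towerP L m (n + 1)) => p.1) χ
  obtain ⟨MS, hMS⟩ := exists_pointwise_clm (𝕜 := ℂ) (w := fun _ : TSite d (towerP L m (n + 1)) => c₀) (V := W) (fun x : TSite d (towerP L m (n + 1)) => x) χ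
  obtain ⟨dQ, dQ', dK, dR⟩ := hQK χ χ' hχ hχ' MB hMB MS hMS MF hMF κ hκr
  refine ContinuousLinearMap.opNorm_le_bound _ (by positivity) fun v => ?_
  -- the eight operator exponentials at this `κ`, as linear maps with their pointwise actions
  have hS : ∀ (g : BondL2K ℂ d (towerP L m (n + 1)) c₀ W) (b : Bond d (towerP L m (n + 1))),
      WL2.equiv ℂ (fun _ : Bond d (towerP L m (n + 1)) => c₀) W
          (((exp (κ • MB) : BondL2K ℂ d (towerP L m (n + 1)) c₀ W →L[ℂ] BondL2K ℂ d (towerP L m (n + 1)) c₀ W) :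
            BondL2K ℂ d (towerP L m (n + 1)) c₀ W →ₗ[ℂ] BondL2K ℂ d (towerP L m (n + 1)) c₀ W) g) b =
        Complex.exp (κ * (χ (bpos b) : ℂ)) • WL2.equiv ℂ (fun _ : Bond d (towerP L m (n + 1)) => c₀) W g b :=
    fun g b => equiv_exp_smul_apply_complex MB (fun b => χ (bpos b)) hMB κ g b
  have hSinv : ∀ (g : BondL2K ℂ d (towerP L m (n + 1)) c₀ W) (b : Bond d (towerP L m (n + 1))),
      WL2.equiv ℂ (fun _ : Bond d (towerP L m (n + 1)) => c₀) W
          (((exp (κ • (-MB)) : BondL2K ℂ d (towerP L m (n + 1)) c₀ W →L[ℂ] BondL2K ℂ d (towerP L m (n + 1)) c₀ W) :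
            BondL2K ℂ d (towerP L m (n + 1)) c₀ W →ₗ[ℂ] BondL2K ℂ d (towerP L m (n + 1)) c₀ W) g) b =
        Complex.exp (-(κ * (χ (bpos b) : ℂ))) • WL2.equiv ℂ (fun _ : Bond d (towerP L m (n + 1)) => c₀) W g b :=
    fun g b => equiv_exp_smul_neg_apply_complex MB (fun b => χ (bpos b)) hMB κ g b
  have hSP : ∀ (g : PlaqL2K ℂ d (towerP L m (n + 1)) c₀ W) (p : B9SectCLatticeCarrier.Plaq d (towerP L m (n + 1))),
      WL2.equiv ℂ (fun _ : B9SectCLatticeCarrier.Plaq d (towerP L m (n + 1)) => c₀) W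
          (((exp (κ • MP) : PlaqL2K ℂ d (towerP L m (n + 1)) c₀ W →L[ℂ] PlaqL2K ℂ d (towerP L m (n + 1)) c₀ W) :
            PlaqL2K ℂ d (towerP L m (n + 1)) c₀ W →ₗ[ℂ] PlaqL2K ℂ d (towerP L m (n + 1)) c₀ W) g) p =
        Complex.exp (κ * (χ p.1 : ℂ)) • WL2.equiv ℂ (fun _ : B9SectCLatticeCarrier.Plaq d (towerP L m (n + 1)) => c₀) W g p :=
    fun g p => equiv_exp_smul_apply_complex MP (fun p : B9SectCLatticeCarrier.Plaq d (towerP L m (n + 1)) => χ p.1) hMP κ g p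
  have hSPinv : ∀ (g : PlaqL2K ℂ d (towerP L m (n + 1)) c₀ W) (p : B9SectCLatticeCarrier.Plaq d (towerP L m (n + 1))),
      WL2.equiv ℂ (fun _ : B9SectCLatticeCarrier.Plaq d (towerP L m (n + 1)) => c₀) W
          (((exp (κ • (-MP)) : PlaqL2K ℂ d (towerP L m (n + 1)) c₀ W →L[ℂ] PlaqL2K ℂ d (towerP L m (n + 1)) c₀ W) :
            PlaqL2K ℂ d (towerP L m (n + 1)) c₀ W →ₗ[ℂ] PlaqL2K ℂ d (towerP L m (n + 1)) c₀ W) g) p =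
        Complex.exp (-(κ * (χ p.1 : ℂ))) • WL2.equiv ℂ (fun _ : B9SectCLatticeCarrier.Plaq d (towerP L m (n + 1)) => c₀) W g p :=
    fun g p => equiv_exp_smul_neg_apply_complex MP (fun p : B9SectCLatticeCarrier.Plaq d (towerP L m (n + 1)) => χ p.1) hMP κ g p
  have hSS : ∀ (g : SiteL2K ℂ d (towerP L m (n + 1)) c₀ W) (x : TSite d (towerP L m (n + 1))),
      WL2.equiv ℂ (fun _ : TSite d (towerP L m (n + 1)) => c₀) W
          (((exp (κ • MS) : SiteL2K ℂ d (towerP L m (n + 1)) c₀ W →L[ℂ] SiteL2K ℂ d (towerP L m (n + 1)) c₀ W) :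
            SiteL2K ℂ d (towerP L m (n + 1)) c₀ W →ₗ[ℂ] SiteL2K ℂ d (towerP L m (n + 1)) c₀ W) g) x =
        Complex.exp (κ * (χ x : ℂ)) • WL2.equiv ℂ (fun _ : TSite d (towerP L m (n + 1)) => c₀) W g x :=
    fun g x => equiv_exp_smul_apply_complex MS χ hMS κ g x
  have hSSinv : ∀ (g : SiteL2K ℂ d (towerP L m (n + 1)) c₀ W) (x : TSite d (towerP L m (n + 1))),
      WL2.equiv ℂ (fun _ : TSite d (towerP L m (n + 1)) => c₀) W
          (((exp (κ • (-MS)) : SiteL2K ℂ d (towerP L m (n + 1)) c₀ W →L[ℂ] SiteL2K ℂ d (towerP L m (n + 1)) c₀ W) :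
            SiteL2K ℂ d (towerP L m (n + 1)) c₀ W →ₗ[ℂ] SiteL2K ℂ d (towerP L m (n + 1)) c₀ W) g) x =
        Complex.exp (-(κ * (χ x : ℂ))) • WL2.equiv ℂ (fun _ : TSite d (towerP L m (n + 1)) => c₀) W g x :=
    fun g x => equiv_exp_smul_neg_apply_complex MS χ hMS κ g x
  have hSF : ∀ (g : BondL2K ℂ d m c₁ W) (b' : Bond d m),
      WL2.equiv ℂ (fun _ : Bond d m => c₁) W
          (((exp (κ • MF) : BondL2K ℂ d m c₁ W →L[ℂ] BondL2K ℂ d m c₁ W) : BondL2K ℂ d m c₁ W →ₗ[ℂ] BondL2K ℂ d m c₁ W) g) b' =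
        Complex.exp (κ * (χ' (bpos b') : ℂ)) • WL2.equiv ℂ (fun _ : Bond d m => c₁) W g b' :=
    fun g b' => equiv_exp_smul_apply_complex MF (fun b' => χ' (bpos b')) hMF κ g b'
  have hSFinv : ∀ (g : BondL2K ℂ d m c₁ W) (b' : Bond d m),
      WL2.equiv ℂ (fun _ : Bond d m => c₁) W
          (((exp (κ • (-MF)) : BondL2K ℂ d m c₁ W →L[ℂ] BondL2K ℂ d m c₁ W) : BondL2K ℂ d m c₁ W →ₗ[ℂ] BondL2K ℂ d m c₁ W) g) b' =
        Complex.exp (-(κ * (χ' (bpos b') : ℂ))) • WL2.equiv ℂ (fun _ : Bond d m => c₁) W g b' :=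
    fun g b' => equiv_exp_smul_neg_apply_complex MF (fun b' => χ' (bpos b')) hMF κ g b'
  have hSFi := apply_inv_apply' κ (fun b' : Bond d m => χ' (bpos b')) hSF hSFinv
  have hSFs := apply_apply_inv' κ (fun b' : Bond d m => χ' (bpos b')) hSF hSFinv
  -- the windows at this `κ`
  have hwinκ : ‖κ‖ * ℓ * η ≤ 1 := by rw [hκr]; exact hwin
  have hβCC' : 4 * ‖κ‖ * ℓ * (Mφ * Mφ') * (d * Real.sqrt d) ≤ β := by rw [hκr]; exact hβCC
  have hβC' : 4 * ‖κ‖ * ℓ * (Mφ * Mφ') * d ≤ β := by rw [hκr]; exact hβC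
  have hβD' : 2 * ‖κ‖ * ℓ * (Mφ * Mφ') * Real.sqrt d ≤ β := by rw [hκr]; exact hβD
  have h := norm_conjKinv_le L m n φ hφ hφ' hMφ hMφ' hη U hU hRS τ hL α hα1 hU1 hreg a
    (S := ((exp (κ • MB) : BondL2K ℂ d (towerP L m (n + 1)) c₀ W →L[ℂ] BondL2K ℂ d (towerP L m (n + 1)) c₀ W) :
      BondL2K ℂ d (towerP L m (n + 1)) c₀ W →ₗ[ℂ] BondL2K ℂ d (towerP L m (n + 1)) c₀ W))
    (Sinv := ((exp (κ • (-MB)) : BondL2K ℂ d (towerP L m (n + 1)) c₀ W →L[ℂ] BondL2K ℂ d (towerP L m (n + 1)) c₀ W) :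
      BondL2K ℂ d (towerP L m (n + 1)) c₀ W →ₗ[ℂ] BondL2K ℂ d (towerP L m (n + 1)) c₀ W))
    hS hSinv hSP hSPinv hSS hSSinv hSFi hSFs ha hpos hQs hγ hγ1 hβ hβ1 hβK (zero_le_one.trans hℓ) hρ hρ8 hCP hCQ hμ₁ hcoer hX1 hKre hQ hχ hwinκ
    hβCC' hβC' hβD'
    (fun f => by simpa only [LinearMap.comp_apply, ContinuousLinearMap.coe_coe] using dQ f)
    (fun g => by simpa only [LinearMap.comp_apply, ContinuousLinearMap.coe_coe] using dQ' g)
    (fun f => by simpa only [LinearMap.comp_apply, ContinuousLinearMap.coe_coe] using dK f)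
    (fun s => by simpa only [LinearMap.comp_apply, ContinuousLinearMap.coe_coe] using dR s) hP small small2 v
  simpa only [ContinuousLinearMap.comp_apply, LinearMap.coe_toContinuousLinearMap', LinearMap.comp_apply, ContinuousLinearMap.coe_coe] using h

end Instance

end Literature.MathematicalPhysics.QuantumFieldTheory.Balaban1983to89.B9Eq3126QG1QInvPointDecayTower

end
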